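import Literature.NumberTheory.EllipticCurves.Rank1Residual.Predicates
import HarnessLib

/-!
# Kraus 1997 (Dissertationes Math. 364), Proposition 2 with Lemmes 1–2: the action of inertia on
# `E[p]` at an ADDITIVE potentially good prime `p ≥ 5` when the good model over `ℚ_p(p^{v(Δ)/12})`
# is SUPERSINGULAR — reducible with a `G_{ℚ_p}`-stable line on six exceptional valuation triplets,
# irreducible otherwise

HONEST FRAMING (cell `b2b-bsdres`, run/shared/lean/b2b/bsd-rank1-residual/; page 1 everywhere):
prove what is provable now; shrink each hard class to its core with data; no claim beyond stated
classes. The cell deletes the COMBINATION-SHAPED residual classes of the BSD formula in analytic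
rank `≤ 1` from PUBLISHED theorems only and TYPES the construction-shaped ones; this is not
"finishing BSD". This file vendors ONE published, refereed theorem as a named fact (`def … : Prop`,
nothing asserted; D-0014) in the cell's vocabulary (`Rank1Residual/Predicates.lean`: `Addv`;
`WeierstrassCurve.HasIrreducibleModPGaloisRep`, `WeierstrassCurve.geomTorsion` of
`Literature/NumberTheory/EllipticCurves/GaloisAction.lean`), plus two census-decidable valuation
predicates that spell its hypotheses, with their unfolding lemmas. It is the PRINTED SOURCE of the
cell's theorem-candidate T-O5-CS `Summit.….Additive.LocIrrTameIffNoCanonicalSubgroup`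
(`Summits/BirchSwinnertonDyer/Rank1Residual/Additive/LocIrrValuationCriterionTame.lean`, p300590,
until now labelled "harvest-2 E94 DERIVATION + numerics, EVIDENCE"): Kraus's six exceptional
triplets (Lemme 2) ARE the six disjuncts of `CanonicalSubgroupCriterion` there. Registry:
HOME/CITED-FACTS.md (harvest seat `b2b-bsdres-harvest-2`, GEN 46, E100); acquisition acq-09682
(filed 2026-08-21 by this lineage as "not held") is RESOLVED by the open-access copy below.

## Citation header (read by this seat, 2026-08-21, every page)

* Author: Alain Kraus (Université de Paris VI).
* Title: *Détermination du poids et du conducteur associés aux représentations des points de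
  `p`-torsion d'une courbe elliptique*.
* Venue: Dissertationes Mathematicae (Rozprawy Matematyczne) **364** (1997), 39 pp., Institute of
  Mathematics, Polish Academy of Sciences, ISSN 0012-3862; received 28.9.1994, revised 20.6.1996;
  MSC 11G; zbl 0881.11053. REFEREED / PUBLISHED. Bib key `Kraus1997Dissertationes`.
* Copy read: Polish Digital Mathematics Library (DML-PL), record
  `bwmeta1.element.zamlynska-79df3abd-a73a-440a-bc4f-fc0a18c11dcf`, file `rm36401.pdf` (38 PDF pages,
  sha256 prefix `1b1a516bee13a4f2`; printed page = PDF page + 1), seat store key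
  `paper:url-debaeff45685`.
* Results vendored: **Proposition 2** (printed p. 10, §I.B.1 no. 2.3.2) with **Lemme 2** (p. 10) and
  **Lemme 1** (p. 8); the `G_{ℚ_p}`-stability sentence of the proof of Prop. 2 (a) (p. 11); the case
  list of §I.B.1 no. 4.2, 1)–3) (pp. 17–20). Standing hypotheses of §I.B.1 (p. 8): `p ≥ 5`, `E/ℚ_p`
  with additive ("mauvaise réduction de type additif") reduction, `v(j) ≥ 0`; `c₄, c₆, Δ` "les
  invariants standards associés à un modèle minimal de `E`"; `v` normalised by `v(p) = 1`;
  `L = ℚ_p(p^{v(Δ)/12})`; `E_L` the curve `(W_L) Y² = X³ − (c₄/48u⁴)X − c₆/(864u⁶)`,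
  `u = p^{v(Δ)/12}`, which has good reduction over `L`; `h ∈ {1, 2}` the height of that reduction
  ("`h = 1` si `E_L` est à réduction ordinaire et `h = 2` si `E_L` est à réduction
  supersingulière"); `I ⊂ G_p = Gal(ℚ̄_p/ℚ_p)` the inertia group; `E_p` = the `p`-torsion of
  `E(ℚ̄_p)`; `χ_α` Serre's characters of `I`, `χ = χ_{1/(p−1)}` cyclotomic, `ψ, ψ′` the fundamental
  characters of level 2; `τ_p` = the coefficient of `T^p` in the multiplication-by-`p` series
  `[p](T)` of the formal group of `(W_L)`.
* Verbatim (pp. 8, 10, 11):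

> **Lemme 1.** (a) Supposons que l'on ait `v(Δ) ∈ {2, 4, 8, 10}` ou que `(v(Δ), v(c₄), v(c₆))` soit
> de la forme `(6, n, 3)` avec `n ≥ 3`. L'invariant modulaire `j(Ẽ_L)` … est `0`. On a `h = 1` si
> `p ≡ 1 mod 3`, et `h = 2` si `p ≡ 2 mod 3`.
> (b) Supposons que l'on ait `v(Δ) ∈ {3, 9}` ou que `(v(Δ), v(c₄), v(c₆))` soit de la forme
> `(6, 2, n)` avec `n ≥ 4`. On a `j(Ẽ_L) = 1728`. On a `h = 1` si `p ≡ 1 mod 4`, et `h = 2` si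
> `p ≡ 3 mod 4`.
>
> **Proposition 2.** Supposons `h = 2`. Posons `α = (p + 1)v(Δ)/12`. Le nombre `α` est entier.
> (a) Supposons `v(τ_p) < p/(p+1)`. Dans une base convenable de `E_p` sur `𝔽_p` la représentation
> de `I` dans `E_p` s'écrit matriciellement `(χ^{1−α} ∗ ; 0 χ^α)` si `v(Δ) < 6`,
> `(χ^{2−α} ∗ ; 0 χ^{α−1})` si `v(Δ) > 6`.
> (b) Supposons `v(τ_p) ≥ p/(p+1)`. La représentation de `I` dans `E_p` est irréductible. La
> représentation de `I` dans `E_p ⊗ 𝔽̄_p` … est diagonalisable et représentable matriciellement …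
> par `(ψ^α ψ′^{p−α} 0 ; 0 ψ′^α ψ^{p−α})`.
>
> **Lemme 2.** Supposons `h = 2`. Si `(v(Δ), v(c₄), v(c₆))` est l'un des triplets `(2, 1, 1)`,
> `(3, 1, 2)`, `(4, 2, 2)`, `(8, 3, 4)`, `(9, 3, 5)`, `(10, 4, 5)`, on a `v(τ_p) = v(Δ)/6` si
> `v(Δ) < 6`, `(v(Δ)/6) − 1` si `v(Δ) > 6`; on a `v(τ_p) ≥ 1` lorsque `(v(Δ), v(c₄), v(c₆))` n'est
> pas l'un des triplets ci-dessus.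
>
> (Proof of Prop. 2 (a), p. 11:) Supposons `v(τ_p) < p/(p+1)`. … l'ensemble `A` des éléments `P` de
> `E_p` pour lesquels `v(T(P)) ≥ α₁` est un sous-groupe d'ordre `p` de `E_p`. Si `P` est un point
> non nul de `E_p`, on a `v(t(P)) = α₁ − v(Δ)/12` ou `v(t(P)) = α₂ − v(Δ)/12` suivant que `P`
> appartient ou non à `A` (formule (1)); ainsi `A` est stable sous l'action de
> `G_p = Gal(ℚ̄_p/ℚ_p)`.

  Composition AS PRINTED in §4.2 (proof of Thm. 1 (b), case `h = 2`, pp. 17–20): cases 1)–2) = the six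
  triplets: "La représentation de `I` dans `E_p` s'écrit matriciellement `(χ^{1−α} ∗ ; 0 χ^α)` [resp.
  `(χ^{2−α} ∗ ; 0 χ^{α−1})`] avec `α = (p+1)v(Δ)/12` (lemme 2 et prop. 2(a)). Le groupe `I_p`
  n'opère pas trivialement sur `E_p` (prop. 4)"; case 3) (p. 19): "Supposons que
  `(v(Δ), v(c₄), v(c₆))` ne soit pas l'un des triplets `(2,1,1), (3,1,2), (4,2,2), (8,3,4), (9,3,5),
  (10,4,5)`. La représentation de `I` dans `E_p ⊗ 𝔽̄_p` … s'écrit … (lemme 2 et prop. 2(b)). Dans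
  cette situation on est dans l'un des cas suivants: • `v(Δ) ∈ {2, 4, 8, 10}` et `p ≡ 2 mod 3`;
  • `v(Δ) ∈ {4 [sic; 3], 9}` et `p ≡ 3 mod 4`; • `v(Δ) = 6`." Since on the six triplets
  `v(Δ)/6, v(Δ)/6 − 1 ∈ {1/3, 1/2, 2/3} < 5/6 ≤ p/(p+1)` and otherwise `v(τ_p) ≥ 1 ≥ p/(p+1)`,
  Lemme 2 decides the alternative of Prop. 2 by the triplet alone (this is how §4.2 uses it).
  Companion statements NOT vendored here (recorded in HOME/b2b-bsdres-harvest-2/HARVEST.md §GEN-46):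
  Thm. 1 (Serre's weight `k` at every additive `p ≥ 5`, pp. 6–7), Prop. 1 (`h = 1`: `(χ^{1−α} ∗ ;
  0 χ^α)`, `α = (p−1)v(Δ)/12`, with a `G_p`-stable kernel of reduction `C_p`, p. 9), Prop. 4 (wild
  inertia acts non-trivially iff the triplet is exceptional, or `(6,3,·) ∧ p ≡ 1 (3)`, or
  `(6,·,4) ∧ p ≡ 1 (4)`, or `(6,2,3) ∧ h = 1 ∧ v(j − j_can) = 1`, p. 14), the `p = 3` section
  (Lemme 8 / Prop. 6 / Prop. 7, pp. 22–23: `E[3]|G_{ℚ₃}` has a stable line iff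
  `v(Δ) ≤ 2v(c₆) ≤ 4 + v(Δ)`, is irreducible iff `2v(c₆) > 4 + v(Δ)`), Prop. 10 (`v(j) < 0`),
  Thm. 2–3 and Part II (Serre conductor `N(ρ̄_p) ∣ N(E)` with the explicit table, p. 28).

## Hypotheses, enumerated (word for word → cell predicate)

1. "`E` une courbe elliptique définie sur `ℚ_p`" — SPECIAL CASE typed: `E = W ⊗ ℚ_p` for
   `W : WeierstrassCurve ℚ`, `[W.IsElliptic]`; the local module is
   `geomTorsion (W.baseChange ℚ_[p]) p = E[p](ℚ̄_p)` with its `Γ_{ℚ_p}`-action.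
   -- TODO(general form): an arbitrary elliptic curve over `ℚ_p` with a `p`-minimal model.
2. "`p ≥ 5`" — `5 ≤ p`.
3. "mauvaise réduction de type additif" — `Addv W p` (the `ℤ_p`-minimal model of `W ⊗ ℚ_p` is
   neither of good nor of multiplicative reduction; `Tamagawa.lean`).
4. "`v(j) ≥ 0`" — `0 ≤ padicValRat p W.j`.
5. "`c₄, c₆, Δ` … d'un modèle minimal" — `[W.IsGloballyMinimal]`, so `W` is a minimal equation at
   `p` and `v(c₄), v(c₆), v(Δ)` are `padicValRat p W.c₄`, `padicValRat p W.c₆`, `padicValRat p W.Δ`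
   (Kraus, p. 6: independent of the minimal model chosen).
6. "`h = 2`" — rendered by Kraus's OWN Lemme 1, i.e. by the census-decidable predicate
   `LemmaOneSupersingular p W` below: (`v(Δ) ∈ {2,4,8,10}` or `(6, ≥3, 3)`) and `p ≡ 2 (mod 3)`, or
   (`v(Δ) ∈ {3,9}` or `(6, 2, ≥4)`) and `p ≡ 3 (mod 4)`. NOT covered by this rendering (and hence
   not by this fact): the generic Kodaira-`I₀*` row `(6, 2, 3)`, where `h` is not a congruence on
   `p` (Kraus, p. 16 top: "sauf lorsque `(v(Δ), v(c₄), v(c₆)) = (6,2,3)`, la valeur de `h` est donnée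
   dans le lemme 1"). On the cell's tame potentially supersingular class O5 at `p ≥ 5` this
   predicate is exactly the `(t′)` cell (`SubTprime`: `e ∈ {3,4,6}`, `e ∤ p − 1`) plus the
   `j̃ ∈ {0, 1728}` part of `(G) ∧ ss`.
7. "`v(τ_p) < p/(p+1)`" / "`v(τ_p) ≥ p/(p+1)`" — decided by Lemme 2: `IsExceptionalTriplet p W` /
   its negation (the six triplets; by Kraus's table p. 8 the companion valuation in each triplet is
   forced, so the triplets are the six disjuncts of the cell's `CanonicalSubgroupCriterion p W`).

Conclusions, AS TYPED (each WEAKER than print): (a) "a subgroup of order `p` of `E_p` stable under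
`G_p`" — `∃ H ≤ E[p](ℚ̄_p)`, `Γ_{ℚ_p}`-stable, `Nat.card H = p` (the inertia characters
`χ^{1−α}, χ^α` / `χ^{2−α}, χ^{α−1}` and "I_p n'opère pas trivialement" are dropped); (b) "la
représentation de `I` dans `E_p` est irréductible" — a fortiori irreducible under `Γ_{ℚ_p} ⊇ I`:
`(W.baseChange ℚ_[p]).HasIrreducibleModPGaloisRep p` (= the cell's `LocIrr W p`,
`Additive/FouquetWanLocus.lean`); the level-2 characters are dropped.

No `_holds` is to be expected soon (formal groups of a twisted model over `ℚ_p(p^{1/e})`, the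
Newton polygon of `[p]`, Serre's `χ_α`, the Hasse-invariant congruence of Kraus's Appendix III: none
in Mathlib); consumers take `(h : propTwo_pTorsion_of_supersingular)`. D-0026: this file introduces
exactly ONE named fact (the published theorem) and two decidable predicates with unfolding lemmas;
nothing else is minted.

## References
* [Kraus1997Dissertationes] A. Kraus, *Détermination du poids et du conducteur associés aux
  représentations des points de p-torsion d'une courbe elliptique*, Dissertationes Math. 364
  (1997), Lemme 1 (p. 8), Prop. 1 (p. 9), Prop. 2 and Lemme 2 (p. 10), proof p. 11, Prop. 4
  (p. 14), §4.2 (pp. 17–20).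
* [Serre1972] J.-P. Serre, Invent. Math. 15 (1972) §1 (characters `χ_α`, `ψ`, `ψ′`; [6] of Kraus).
* N. Billerey, IJNT 7 (2011) = arXiv:0908.1084, Prop. 2.3 and Remarque (restates the inertia part
  of Kraus's Prop. 1–2 as `λ¹²|_{I_p} = χ^α`, `α ∈ {0, 4, 6, 8, 12}`).
* Cell: `Summits/…/Additive/LocIrrValuationCriterionTame.lean` (T-O5-CS, p300590);
  HOME/b2b-bsdres-harvest-2/gen43/E94-F25-B2-correction.md, gen44/E96-LocRed-B-table.md,
  gen46/E100-Kraus1997-fidelity-read.md.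
-/

noncomputable section

open scoped Classical

open WeierstrassCurve Literature.NumberTheory.EllipticCurves
  Literature.NumberTheory.EllipticCurves.Rank1Residual

namespace Literature.NumberTheory.EllipticCurves.Kraus1997

/-! ## §1 The two valuation predicates of Lemme 1 and Lemme 2 (census-decidable) -/

/-- **Kraus's six exceptional triplets** `(v(Δ), v(c₄), v(c₆)) ∈ {(2,1,1), (3,1,2), (4,2,2),
(8,3,4), (9,3,5), (10,4,5)}` of a minimal model at `p` (Lemme 2, p. 10; = §4.2 cases 1)(a)(b)(c),
2)(a)(b)(c), pp. 17–19) — the rows on which `v(τ_p) < 1`. On a globally minimal `W` the valuations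
are `padicValRat p` of `W.Δ, W.c₄, W.c₆`. [cite: Kraus1997Dissertationes, Lemme 2 (p. 10)] -/
def IsExceptionalTriplet (p : ℕ) (W : WeierstrassCurve ℚ) : Prop :=
  (padicValRat p W.Δ = 2 ∧ padicValRat p W.c₄ = 1 ∧ padicValRat p W.c₆ = 1) ∨
  (padicValRat p W.Δ = 3 ∧ padicValRat p W.c₄ = 1 ∧ padicValRat p W.c₆ = 2) ∨
  (padicValRat p W.Δ = 4 ∧ padicValRat p W.c₄ = 2 ∧ padicValRat p W.c₆ = 2) ∨
  (padicValRat p W.Δ = 8 ∧ padicValRat p W.c₄ = 3 ∧ padicValRat p W.c₆ = 4) ∨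
  (padicValRat p W.Δ = 9 ∧ padicValRat p W.c₄ = 3 ∧ padicValRat p W.c₆ = 5) ∨
  (padicValRat p W.Δ = 10 ∧ padicValRat p W.c₄ = 4 ∧ padicValRat p W.c₆ = 5)

/-- **The `h = 2` rows of Kraus's Lemme 1** (p. 8): the reduction of the good model `E_L` over
`L = ℚ_p(p^{v(Δ)/12})` is SUPERSINGULAR when (a) `v(Δ) ∈ {2, 4, 8, 10}` or
`(v(Δ), v(c₄), v(c₆)) = (6, n, 3)` with `n ≥ 3` (then `j(Ẽ_L) = 0`), and `p ≡ 2 (mod 3)`; or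
(b) `v(Δ) ∈ {3, 9}` or `(v(Δ), v(c₄), v(c₆)) = (6, 2, n)` with `n ≥ 4` (then `j(Ẽ_L) = 1728`), and
`p ≡ 3 (mod 4)`. (Lemme 1 also gives `h = 1` under the complementary congruences; the generic
`I₀*` row `(6, 2, 3)` is outside Lemme 1.) Junk-safe and slightly NARROWER than print on the two
`v(Δ) = 6` rows: Lean's `v_p(0) = 0` excludes `c₄ = 0` (`j = 0`, Kraus's `n = ∞ ≥ 3`) from row (a)
and `c₆ = 0` (`j = 1728`) from row (b); the rows `v(Δ) ∈ {2,3,4,8,9,10}` carry no inequality.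
[cite: Kraus1997Dissertationes, Lemme 1 (p. 8)] -/
def LemmaOneSupersingular (p : ℕ) (W : WeierstrassCurve ℚ) : Prop :=
  ((padicValRat p W.Δ = 2 ∨ padicValRat p W.Δ = 4 ∨ padicValRat p W.Δ = 8 ∨
      padicValRat p W.Δ = 10 ∨
      (padicValRat p W.Δ = 6 ∧ padicValRat p W.c₆ = 3 ∧ 3 ≤ padicValRat p W.c₄)) ∧ p % 3 = 2) ∨
  ((padicValRat p W.Δ = 3 ∨ padicValRat p W.Δ = 9 ∨
      (padicValRat p W.Δ = 6 ∧ padicValRat p W.c₄ = 2 ∧ 4 ≤ padicValRat p W.c₆)) ∧ p % 4 = 3)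

/-- Unfolding of `IsExceptionalTriplet`. [cite: Kraus1997Dissertationes, Lemme 2 (p. 10)] -/
theorem isExceptionalTriplet_iff (p : ℕ) (W : WeierstrassCurve ℚ) :
    IsExceptionalTriplet p W ↔
      (padicValRat p W.Δ = 2 ∧ padicValRat p W.c₄ = 1 ∧ padicValRat p W.c₆ = 1) ∨
      (padicValRat p W.Δ = 3 ∧ padicValRat p W.c₄ = 1 ∧ padicValRat p W.c₆ = 2) ∨
      (padicValRat p W.Δ = 4 ∧ padicValRat p W.c₄ = 2 ∧ padicValRat p W.c₆ = 2) ∨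
      (padicValRat p W.Δ = 8 ∧ padicValRat p W.c₄ = 3 ∧ padicValRat p W.c₆ = 4) ∨
      (padicValRat p W.Δ = 9 ∧ padicValRat p W.c₄ = 3 ∧ padicValRat p W.c₆ = 5) ∨
      (padicValRat p W.Δ = 10 ∧ padicValRat p W.c₄ = 4 ∧ padicValRat p W.c₆ = 5) :=
  Iff.rfl

/-- Unfolding of `LemmaOneSupersingular`. [cite: Kraus1997Dissertationes, Lemme 1 (p. 8)] -/
theorem lemmaOneSupersingular_iff (p : ℕ) (W : WeierstrassCurve ℚ) :
    LemmaOneSupersingular p W ↔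
      ((padicValRat p W.Δ = 2 ∨ padicValRat p W.Δ = 4 ∨ padicValRat p W.Δ = 8 ∨
          padicValRat p W.Δ = 10 ∨
          (padicValRat p W.Δ = 6 ∧ padicValRat p W.c₆ = 3 ∧ 3 ≤ padicValRat p W.c₄)) ∧
        p % 3 = 2) ∨
      ((padicValRat p W.Δ = 3 ∨ padicValRat p W.Δ = 9 ∨
          (padicValRat p W.Δ = 6 ∧ padicValRat p W.c₄ = 2 ∧ 4 ≤ padicValRat p W.c₆)) ∧
        p % 4 = 3) :=
  Iff.rfl

/-- An exceptional triplet has `v(Δ) ∈ {2, 3, 4, 8, 9, 10}`; in particular `v(Δ) ≠ 6` (the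
Kodaira-`I₀*` rows are never exceptional — Lemme 2: "Lorsque `v(Δ) = 6` … `v(τ_p) ≥ 1`").
[cite: Kraus1997Dissertationes, Lemme 2 (p. 10) and its proof (p. 11)] -/
theorem IsExceptionalTriplet.padicValRat_Δ_ne_six {p : ℕ} {W : WeierstrassCurve ℚ}
    (h : IsExceptionalTriplet p W) : padicValRat p W.Δ ≠ 6 := by
  rcases h with h | h | h | h | h | h <;> (rw [h.1]; norm_num)

/-- On an exceptional triplet the supersingularity predicate of Lemme 1 is a bare congruence on
`p`: `p ≡ 2 (mod 3)` when `v(Δ) ∈ {2, 4, 8, 10}`, `p ≡ 3 (mod 4)` when `v(Δ) ∈ {3, 9}` (as printed in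
§4.2 1)–2): "(et donc `p ≡ 2 mod 3`, d'après le lemme 1)" etc.).
[cite: Kraus1997Dissertationes, §I.B.1 no. 4.2 1)–2) (pp. 17–19)] -/
theorem lemmaOneSupersingular_iff_of_isExceptionalTriplet {p : ℕ} {W : WeierstrassCurve ℚ}
    (h : IsExceptionalTriplet p W) :
    LemmaOneSupersingular p W ↔
      ((padicValRat p W.Δ = 2 ∨ padicValRat p W.Δ = 4 ∨ padicValRat p W.Δ = 8 ∨
          padicValRat p W.Δ = 10) ∧ p % 3 = 2) ∨
      ((padicValRat p W.Δ = 3 ∨ padicValRat p W.Δ = 9) ∧ p % 4 = 3) := by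
  have h6 := h.padicValRat_Δ_ne_six
  unfold LemmaOneSupersingular
  constructor
  · rintro (⟨hΔ, hp⟩ | ⟨hΔ, hp⟩)
    · left
      refine ⟨?_, hp⟩
      rcases hΔ with hΔ | hΔ | hΔ | hΔ | hΔ
      · exact Or.inl hΔ
      · exact Or.inr (Or.inl hΔ)
      · exact Or.inr (Or.inr (Or.inl hΔ))
      · exact Or.inr (Or.inr (Or.inr hΔ))
      · exact absurd hΔ.1 h6
    · right
      refine ⟨?_, hp⟩
      rcases hΔ with hΔ | hΔ | hΔ
      · exact Or.inl hΔ
      · exact Or.inr hΔ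
      · exact absurd hΔ.1 h6
  · rintro (⟨hΔ, hp⟩ | ⟨hΔ, hp⟩)
    · left
      refine ⟨?_, hp⟩
      rcases hΔ with hΔ | hΔ | hΔ | hΔ
      · exact Or.inl hΔ
      · exact Or.inr (Or.inl hΔ)
      · exact Or.inr (Or.inr (Or.inl hΔ))
      · exact Or.inr (Or.inr (Or.inr (Or.inl hΔ)))
    · right
      refine ⟨?_, hp⟩
      rcases hΔ with hΔ | hΔ
      · exact Or.inl hΔ
      · exact Or.inr (Or.inl hΔ)

/-! ## §2 The named fact (Prop. 2 with Lemmes 1–2; nothing asserted) -/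

/-- **Kraus, Dissertationes Math. 364 (1997), Proposition 2 (p. 10), with the hypothesis `h = 2`
supplied by Lemme 1 (p. 8) and the alternative `v(τ_p) < p/(p+1)` / `v(τ_p) ≥ p/(p+1)` decided by
Lemme 2 (p. 10), exactly as composed in the proof of Théorème 1 (b), §4.2 1)–3) (pp. 17–20).**
Let `p ≥ 5` be prime and `E = W ⊗ ℚ_p` for an elliptic curve `W/ℚ` given by a globally minimal
equation (so `c₄, c₆, Δ` are the invariants of a minimal model at `p`), with ADDITIVE reduction at
`p` and `v_p(j) ≥ 0`, and suppose the good model over `ℚ_p(p^{v(Δ)/12})` has SUPERSINGULAR reduction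
by Lemme 1 (`LemmaOneSupersingular p W`). Then:
(a) if `(v(Δ), v(c₄), v(c₆))` is one of `(2,1,1), (3,1,2), (4,2,2), (8,3,4), (9,3,5), (10,4,5)`, the
`p`-torsion `E[p](ℚ̄_p)` contains a subgroup of order `p` stable under `Gal(ℚ̄_p/ℚ_p)` (print: "`A`
est un sous-groupe d'ordre `p` de `E_p` … stable sous l'action de `G_p`", p. 11, and `I` acts by
`(χ^{1−α} ∗ ; 0 χ^α)` resp. `(χ^{2−α} ∗ ; 0 χ^{α−1})`, `α = (p+1)v(Δ)/12` — the characters are not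
typed: WEAKER than print);
(b) otherwise the representation of the inertia group `I` on `E[p]` is irreducible — typed as
irreducibility under the whole `Gal(ℚ̄_p/ℚ_p) ⊇ I` (WEAKER than print; the level-2 characters
`ψ^α ψ′^{p−α}, ψ′^α ψ^{p−α}` of (b) are not typed).
Special case of the printed local statement (any `E/ℚ_p`) for base changes of global minimal curves.
[cite: Kraus1997Dissertationes, Prop. 2 (p. 10), Lemme 1 (p. 8), Lemme 2 (p. 10), proof of Prop. 2 (a) (p. 11), §I.B.1 no. 4.2 (pp. 17–20)] -/
def propTwo_pTorsion_of_supersingular : Prop :=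
  ∀ (p : ℕ) [Fact p.Prime], 5 ≤ p →
    ∀ (W : WeierstrassCurve ℚ) [W.IsElliptic] [W.IsGloballyMinimal],
      Addv W p → 0 ≤ padicValRat p W.j → LemmaOneSupersingular p W →
        (IsExceptionalTriplet p W →
            ∃ H : AddSubgroup (geomTorsion (W.baseChange ℚ_[p]) (p : ℤ)),
              (∀ (σ : Field.absoluteGaloisGroup ℚ_[p])
                  (P : geomTorsion (W.baseChange ℚ_[p]) (p : ℤ)), P ∈ H → σ • P ∈ H) ∧
                Nat.card H = p) ∧
          (¬ IsExceptionalTriplet p W → (W.baseChange ℚ_[p]).HasIrreducibleModPGaloisRep p)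

/-! ## §3 Proved consumers of the fact (nothing asserted beyond it) -/

section Consumers

variable {p : ℕ} [Fact p.Prime] (W : WeierstrassCurve ℚ) [W.IsElliptic] [W.IsGloballyMinimal]

/-- Prop. 2 (b) read off the fact: outside the six triplets, `E[p]|G_{ℚ_p}` is irreducible.
[cite: Kraus1997Dissertationes, Prop. 2 (b) (p. 10) and §I.B.1 no. 4.2 3) (pp. 19–20)] -/
theorem hasIrreducibleModPGaloisRep_baseChange_of_not_isExceptionalTriplet
    (h : propTwo_pTorsion_of_supersingular) (hp : 5 ≤ p) (hadd : Addv W p)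
    (hj : 0 ≤ padicValRat p W.j) (hss : LemmaOneSupersingular p W)
    (hne : ¬ IsExceptionalTriplet p W) :
    (W.baseChange ℚ_[p]).HasIrreducibleModPGaloisRep p :=
  (h p hp W hadd hj hss).2 hne

/-- Prop. 2 (a) read off the fact: on the six triplets there is a `G_{ℚ_p}`-stable subgroup of
order `p` in `E[p](ℚ̄_p)`.
[cite: Kraus1997Dissertationes, Prop. 2 (a) (p. 10), proof p. 11, §I.B.1 no. 4.2 1)–2) (pp. 17–19)] -/
theorem exists_stable_addSubgroup_of_isExceptionalTriplet
    (h : propTwo_pTorsion_of_supersingular) (hp : 5 ≤ p) (hadd : Addv W p)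
    (hj : 0 ≤ padicValRat p W.j) (hss : LemmaOneSupersingular p W)
    (he : IsExceptionalTriplet p W) :
    ∃ H : AddSubgroup (geomTorsion (W.baseChange ℚ_[p]) (p : ℤ)),
      (∀ (σ : Field.absoluteGaloisGroup ℚ_[p]) (P : geomTorsion (W.baseChange ℚ_[p]) (p : ℤ)),
          P ∈ H → σ • P ∈ H) ∧ Nat.card H = p :=
  (h p hp W hadd hj hss).1 he

end Consumers

end Literature.NumberTheory.EllipticCurves.Kraus1997
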